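import Mathlib.Analysis.SpecialFunctions.Gaussian.FourierTransform
import Mathlib.Analysis.SpecialFunctions.Gaussian.PoissonSummation
import Mathlib.MeasureTheory.Integral.IntegralEqImproper
import Mathlib.Analysis.Complex.UpperHalfPlane.Basic
import Mathlib.Analysis.InnerProductSpace.PiL2
import HarnessLib

/-!
# The Fourier transform of Shintani's Schwartz function on the space of binary quadratic forms

First file of a formalisation of Shintani's theta lift `S₂(Γ₀(32)) → 𝔖₃(128, χ₂)` (Shintani 1975,
Thm. 1–2, for the congruent-number newform `φ = η(4z)²η(8z)²`; the aim is Waldspurger's relation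
behind Tunnell's theorem, `Literature.NumberTheory.EllipticCurves.Tunnell1983.Tunnell1983_waldspurger_chi2`).
The analytic input of the modularity of Shintani's theta kernel in the half-integral weight
variable is the Poisson summation formula (in the tree:
`Literature.NumberTheory.LFunctions.Fourier.tsum_eq_tsum_fourier_of_rpow_decay`) applied to the
**Schwartz function of Remark 2.1 of Shintani 1975** on the three-dimensional space `V` of real
binary quadratic forms `x = [x₀, x₁, x₂] = x₀X² + x₁XY + x₂Y²` with the discriminant form
`disc x = x₁² - 4x₀x₂` (signature `(2,1)`):

  `f_{w,z}(x) = x(w,1) · exp(2πi (Re z · disc x + i Im z · q_w⁺(x)))`,  `w, z ∈ ℍ`,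

where `x(w,1) = x₀w² + x₁w + x₂` (a complex linear form vanishing exactly on the negative line
`ℝ · |X - wY|²/Im w` of the majorant decomposition at `w`), `p_w(x) = (x₀|w|² + x₁ Re w + x₂)/Im w`
and `q_w⁺(x) = disc x + 2 p_w(x)² = |x(w,1)|²/(Im w)² + p_w(x)²` is the positive majorant at `w`
(`shintaniFn`; at `w = i` this is Shintani's `(x₁ - ix₂ - x₃) exp(-πM(2x₁² + x₂² + 2x₃²))` up to
his normalisations). This file PROVES its Fourier transform in closed form, for every `w`:

* `fourier_shintaniFn` — **`𝓕 f_{w,z} (ξ) = κ(z) · f_{w,-1/(4z)}(S⁻¹ξ)`**, where `𝓕` is Mathlib's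
  Fourier transform on the euclidean space `V = ℝ³` (`𝓕 f (ξ) = ∫ e^{-2πi⟪x,ξ⟫} f(x) dx`),
  `S⁻¹ξ = (-ξ₂/2, ξ₁, -ξ₀/2)` (`sinv`, the inverse Gram matrix of `disc`), and
  `κ(z) = (2z)⁻¹ (4i z̄)^{-1/2} (-2iz)^{-1/2} (-4iz)^{-1/2}` (`kappa`, principal branches; the three
  numbers have positive real part). Thus the family is stable under `𝓕` with `z ↦ -1/(4z)`
  (`invFour`) — the shape behind the weight-`3/2` theta multiplier of the kernel.

Proof. (1) At the base point `w = i` the quadratic form in the exponent is diagonal in the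
orthonormal frame `s = (x₀+x₂)/√2`, `b = x₁`, `t = (x₂-x₀)/√2` (`frame`, `rot`, an
`OrthonormalBasis` of `V`): `Re z · disc + i Im z · q_i⁺ = z(b² + 2t²) - 2 z̄ s²` and
`x(i,1) = √2 t + i b` (`shintaniFn_I`), so `f_{i,z} ∘ R⁻¹` is a sum of two pure tensors of
one-variable Gaussians `e^{-πau²}` (`Re a > 0`) and first moments `u e^{-πau²}` (`fRot_eq`).
(2) `𝓕` commutes with the rotation (Mathlib `fourier_comp_linearIsometry`), factors over pure
tensors (`fourier_euclidean_prod`, Fubini), and in one variable `𝓕(e^{-πau²}) = a^{-1/2}e^{-πη²/a}`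
(Mathlib `fourier_gaussian_pi`) and `𝓕(u e^{-πau²}) = -(iη/a) a^{-1/2} e^{-πη²/a}`
(`fourier_mul_gaussian_pi`, from the first-moment identity `∫ x e^{bx²+cx} = -(c/2b) ∫ e^{bx²+cx}`,
`integral_mul_cexp_quadratic`, proved by integration by parts). (3) Reassembling the exponent and
the linear factor in the dual variable gives `κ(z) f_{i,-1/(4z)}(S⁻¹ξ)` (`gauss_factor_eq`,
`poly_factor_eq`, `fourier_shintaniFn_I`). (4) For general `w = g_w · i`,
`g_w = (v^{1/2}, uv^{-1/2}; 0, v^{-1/2})`, one has `f_{w,z} = Im w · f_{i,z} ∘ M_w` with the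
linear map `M_w : x ↦ x ∘ g_w` of determinant `1` (`mLin`, `shintaniFn_eq_mLin`: `M_w` preserves
`disc`, transports the majorant, and `(M_w x)(i,1) = x(w,1)/Im w`), and the Fourier transform of a
linear substitution is `𝓕(f ∘ A)(ξ) = |det A|⁻¹ 𝓕 f((A⁻¹)ᵀξ)` (`fourier_comp_linearMap`, from
Mathlib's `map_linearMap_addHaar_eq_smul_addHaar`); since `M_w S⁻¹ = S⁻¹ (M_w⁻¹)ᵀ` (`mLin_sinv`,
`M_w` being an isometry of `disc`) the base-point formula transports to `w`.

No named facts are introduced; everything is proved.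

## References

* T. Shintani, *On construction of holomorphic cusp forms of half integral weight*, Nagoya Math.
  J. 58 (1975) 83–126: §1.6 Prop. 1.6 (transformation formulae of theta series via Weil's
  theory), §2.1–2.3, Remark 2.1 (the Schwartz function `(x₁ - ix₂ - x₃)^k e^{-πM(2x₁²+x₂²+2x₃²)}`,
  `k = 1`), (2.12) (equivariance in the base point). [Shintani1975]
-/

noncomputable section

open Complex MeasureTheory Filter Topology Real Asymptotics
open scoped FourierTransform RealInnerProductSpace

namespace Literature.NumberTheory.EllipticCurves.Shintani

/-- `e^{b x² + c x} → 0` as `x → +∞` for `Re b < 0`. [folklore] -/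
theorem tendsto_cexp_quadratic_atTop {b : ℂ} (hb : b.re < 0) (c : ℂ) :
    Tendsto (fun x : ℝ ↦ cexp (b * x ^ 2 + c * x)) atTop (𝓝 0) := by
  have h := cexp_neg_quadratic_isLittleO_rpow_atTop hb c 0
  have h2 : (fun x : ℝ ↦ cexp (b * x ^ 2 + c * x)) =o[atTop] fun _ : ℝ ↦ (1 : ℝ) :=
    h.trans_isBigO (IsBigO.of_bound 1 (by
      filter_upwards with x
      simp [Real.rpow_zero]))
  exact (isLittleO_one_iff ℝ).mp h2

/-- `e^{b x² + c x} → 0` as `x → -∞` for `Re b < 0`. [folklore] -/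
theorem tendsto_cexp_quadratic_atBot {b : ℂ} (hb : b.re < 0) (c : ℂ) :
    Tendsto (fun x : ℝ ↦ cexp (b * x ^ 2 + c * x)) atBot (𝓝 0) := by
  have h := (tendsto_cexp_quadratic_atTop hb (-c)).comp tendsto_neg_atBot_atTop
  refine h.congr fun x ↦ ?_
  simp only [Function.comp_apply]
  congr 1
  push_cast
  ring

/-- `x e^{b x² + c x}` is integrable on `ℝ` for `Re b < 0` (dominate `|x| ≤ eˣ + e⁻ˣ`).
[folklore] -/
theorem integrable_mul_cexp_quadratic {b : ℂ} (hb : b.re < 0) (c : ℂ) :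
    Integrable fun x : ℝ ↦ (x : ℂ) * cexp (b * x ^ 2 + c * x) := by
  have h1 := integrable_cexp_quadratic' hb (c + 1) 0
  have h2 := integrable_cexp_quadratic' hb (c - 1) 0
  simp only [add_zero] at h1 h2
  refine (h1.norm.add h2.norm).mono' (by fun_prop) (ae_of_all _ fun x ↦ ?_)
  have hx : |x| ≤ Real.exp x + Real.exp (-x) := by
    rcases le_total 0 x with h | h
    · rw [abs_of_nonneg h]
      linarith [Real.add_one_le_exp x, Real.exp_pos (-x)]
    · rw [abs_of_nonpos h]
      linarith [Real.add_one_le_exp (-x), Real.exp_pos x]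
  have e1 : cexp (b * x ^ 2 + (c + 1) * x) = cexp (b * x ^ 2 + c * x) * Real.exp x := by
    rw [ofReal_exp, ← Complex.exp_add]; ring_nf
  have e2 : cexp (b * x ^ 2 + (c - 1) * x) = cexp (b * x ^ 2 + c * x) * Real.exp (-x) := by
    rw [ofReal_exp, ← Complex.exp_add]; push_cast; ring_nf
  simp only [Pi.add_apply, e1, e2, norm_mul, norm_real, Real.norm_eq_abs,
    abs_of_pos (Real.exp_pos _)]
  rw [mul_comm, ← mul_add]
  exact mul_le_mul_of_nonneg_left hx (norm_nonneg _)

/-- **First Gaussian moment by integration by parts**: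
`∫ x e^{b x² + c x} dx = -(c / 2b) ∫ e^{b x² + c x} dx` for `Re b < 0`, from
`d/dx e^{b x² + c x} = (2bx + c) e^{b x² + c x}` and `∫ (d/dx …) = 0`. [folklore] -/
theorem integral_mul_cexp_quadratic {b : ℂ} (hb : b.re < 0) (c : ℂ) :
    ∫ x : ℝ, (x : ℂ) * cexp (b * x ^ 2 + c * x) =
      -(c / (2 * b)) * ∫ x : ℝ, cexp (b * x ^ 2 + c * x) := by
  have hb0 : b ≠ 0 := by rintro rfl; simp at hb
  set g : ℝ → ℂ := fun x ↦ cexp (b * x ^ 2 + c * x) with hg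
  have hderiv : ∀ x : ℝ, HasDerivAt g ((2 * b * x + c) * g x) x := fun x ↦ by
    have hc : HasDerivAt (fun y : ℝ ↦ (y : ℂ)) 1 x := by
      simpa using (hasDerivAt_id x).ofReal_comp
    have h1 : HasDerivAt (fun y : ℝ ↦ b * (y : ℂ) ^ 2 + c * y) (b * (2 * x) + c) x :=
      (((hc.pow 2).const_mul b).add (hc.const_mul c)).congr_deriv (by norm_num)
    have h2 := h1.cexp
    convert h2 using 1
    simp only [hg]
    ring
  have hgi : Integrable g := by
    simpa only [add_zero] using integrable_cexp_quadratic' hb c 0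
  have hxgi : Integrable fun x : ℝ ↦ (x : ℂ) * g x := integrable_mul_cexp_quadratic hb c
  have hg'i : Integrable fun x : ℝ ↦ (2 * b * x + c) * g x := by
    have := (hxgi.const_mul (2 * b)).add (hgi.const_mul c)
    refine this.congr (ae_of_all _ fun x ↦ ?_)
    simp only [Pi.add_apply]; ring
  have h0 : ∫ x : ℝ, (2 * b * x + c) * g x = 0 := by
    have := integral_of_hasDerivAt_of_tendsto hderiv hg'i (tendsto_cexp_quadratic_atBot hb c)
      (tendsto_cexp_quadratic_atTop hb c)
    simpa using this
  have hsplit : ∫ x : ℝ, (2 * b * x + c) * g x =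
      2 * b * (∫ x : ℝ, (x : ℂ) * g x) + c * ∫ x : ℝ, g x := by
    calc ∫ x : ℝ, (2 * b * x + c) * g x
        = ∫ x : ℝ, (2 * b * ((x : ℂ) * g x) + c * g x) :=
          integral_congr_ae (ae_of_all _ fun x ↦ by simp only; ring)
      _ = (∫ x : ℝ, 2 * b * ((x : ℂ) * g x)) + ∫ x : ℝ, c * g x :=
          integral_add (hxgi.const_mul _) (hgi.const_mul _)
      _ = 2 * b * (∫ x : ℝ, (x : ℂ) * g x) + c * ∫ x : ℝ, g x := by
          simp only [integral_const_mul]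
  rw [hsplit] at h0
  have h2b : (2 * b) ≠ 0 := mul_ne_zero two_ne_zero hb0
  have key : 2 * b * (∫ x : ℝ, (x : ℂ) * g x) = -(c * ∫ x : ℝ, g x) :=
    eq_neg_of_add_eq_zero_left h0
  calc ∫ x : ℝ, (x : ℂ) * g x = (2 * b)⁻¹ * (2 * b * ∫ x : ℝ, (x : ℂ) * g x) := by
        field_simp
    _ = -(c / (2 * b)) * ∫ x : ℝ, g x := by rw [key]; field_simp

/-- **Product rule for the Fourier transform on `ℝⁿ`**: for `g_i : ℝ → ℂ`,
`𝓕 (v ↦ ∏ g_i(v_i)) (ξ) = ∏ 𝓕 g_i (ξ_i)` on `EuclideanSpace ℝ ι` (Fubini). [folklore] -/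
theorem fourier_euclidean_prod {ι : Type*} [Fintype ι] (g : ι → ℝ → ℂ)
    (ξ : EuclideanSpace ℝ ι) :
    𝓕 (fun v : EuclideanSpace ℝ ι ↦ ∏ i, g i (v i)) ξ = ∏ i, 𝓕 (g i) (ξ i) := by
  rw [fourier_eq']
  have hinner : ∀ v : EuclideanSpace ℝ ι, ⟪v, ξ⟫ = ∑ i, v i * ξ i := fun v ↦ by
    simp [PiLp.inner_apply, mul_comm]
  have step1 : ∀ v : EuclideanSpace ℝ ι,
      cexp (↑(-2 * π * ⟪v, ξ⟫) * I) • ∏ i, g i (v i) =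
        ∏ i, (cexp (↑(-2 * π * v i * ξ i) * I) * g i (v i)) := fun v ↦ by
    have hexp : (↑(-2 * π * ⟪v, ξ⟫) * I : ℂ) = ∑ i, (↑(-2 * π * v i * ξ i) * I : ℂ) := by
      rw [hinner]
      push_cast
      rw [Finset.mul_sum, Finset.sum_mul]
      exact Finset.sum_congr rfl fun i _ ↦ by ring
    rw [hexp, Complex.exp_sum, smul_eq_mul, Finset.prod_mul_distrib]
  simp_rw [step1]
  rw [← (PiLp.volume_preserving_toLp ι).integral_comp (MeasurableEquiv.toLp 2 _).measurableEmbedding]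
  change ∫ x : ι → ℝ, ∏ i, (cexp (↑(-2 * π * x i * ξ i) * I) * g i (x i)) = _
  rw [integral_fintype_prod_volume_eq_prod
    (f := fun i (y : ℝ) ↦ cexp (↑(-2 * π * y * ξ i) * I) * g i y)]
  refine Finset.prod_congr rfl fun i _ ↦ ?_
  rw [fourier_real_eq_integral_exp_smul]
  rfl


/-- **Fourier transform of `x e^{-π b x²}`**: `𝓕 (x e^{-πbx²})(t) = -(i t / b) · b^{-1/2} e^{-π t²/b}`
for `Re b > 0` (first moment by parts, `integral_mul_cexp_quadratic`). [folklore] -/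
theorem fourier_mul_gaussian_pi {b : ℂ} (hb : 0 < b.re) (t : ℝ) :
    𝓕 (fun x : ℝ ↦ (x : ℂ) * cexp (-π * b * x ^ 2)) t =
      -(I * t / b) * (1 / b ^ (1 / 2 : ℂ) * cexp (-π / b * t ^ 2)) := by
  have hb0 : b ≠ 0 := by rintro rfl; simp at hb
  have hB : (-π * b).re < 0 := by
    simpa only [neg_mul, neg_re, re_ofReal_mul, neg_lt_zero] using mul_pos pi_pos hb
  -- rewrite both Fourier integrals as Gaussian integrals with a linear term
  have key : ∀ (g : ℝ → ℂ), 𝓕 (fun x : ℝ ↦ g x * cexp (-π * b * x ^ 2)) t =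
      ∫ x : ℝ, g x * cexp (-π * b * x ^ 2 + (-2 * π * I * t) * x) := fun g ↦ by
    rw [fourier_real_eq_integral_exp_smul]
    refine integral_congr_ae (ae_of_all _ fun x ↦ ?_)
    simp only [smul_eq_mul]
    rw [show (-π * b * x ^ 2 + (-2 * π * I * t) * x : ℂ) =
      (↑(-2 * π * x * t) * I) + (-π * b * x ^ 2) by push_cast; ring, Complex.exp_add]
    ring
  have h1 := key (fun x ↦ (x : ℂ))
  have h0 := key (fun _ ↦ 1)
  simp only [one_mul] at h0
  rw [h1, integral_mul_cexp_quadratic hB, ← h0, congrFun (fourier_gaussian_pi hb) t]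
  congr 1
  field_simp


open UpperHalfPlane hiding I

/-! ## The Shintani–Schwartz function on the space of binary quadratic forms -/

/-- Coefficient space of real binary quadratic forms `[x₀, x₁, x₂] = x₀ X² + x₁ XY + x₂ Y²`. [folklore] -/
abbrev V := EuclideanSpace ℝ (Fin 3)

/-- The discriminant `x₁² - 4 x₀ x₂`. [folklore] -/
def disc (x : V) : ℝ := x 1 ^ 2 - 4 * x 0 * x 2

/-- `x(w, 1) = x₀ w² + x₁ w + x₂`. [folklore] -/
def formEval (x : V) (w : ℂ) : ℂ := x 0 * w ^ 2 + x 1 * w + x 2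

/-- Shintani's `p_w(x) = (x₀ |w|² + x₁ Re w + x₂) / Im w` (the component along the negative line). [folklore] -/
def pw (w : ℍ) (x : V) : ℝ := (x 0 * Complex.normSq (w : ℂ) + x 1 * w.re + x 2) / w.im

/-- The majorant `q_w⁺(x) = disc x + 2 p_w(x)²` (positive definite). [folklore] -/
def majorant (w : ℍ) (x : V) : ℝ := disc x + 2 * pw w x ^ 2

/-- Shintani's Schwartz function `x(w,1) · e^{2πi (Re z · disc x + i Im z · q_w⁺(x))}`
(weight `2 ↔ 3/2` kernel). [folklore] -/
def shintaniFn (w z : ℍ) (x : V) : ℂ :=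
  formEval x w * cexp (2 * π * I * ((z : ℂ).re * disc x + I * ((z : ℂ).im * majorant w x)))

/-! ### The base point `w = i`: rotation to principal axes -/

/-- The orthonormal frame `(X² + Y²)/√2`, `XY`, `(Y² - X²)/√2` adapted to `w = i`. [folklore] -/
def frame : Fin 3 → V :=
  ![!₂[1 / Real.sqrt 2, 0, 1 / Real.sqrt 2], !₂[0, 1, 0], !₂[-(1 / Real.sqrt 2), 0, 1 / Real.sqrt 2]]

/-- The frame is orthonormal. [folklore] -/
theorem frame_orthonormal : Orthonormal ℝ frame := by
  rw [orthonormal_iff_ite]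
  have key : (Real.sqrt 2)⁻¹ * (Real.sqrt 2)⁻¹ = 1 / 2 := by
    rw [← mul_inv, Real.mul_self_sqrt (by norm_num : (0:ℝ) ≤ 2)]; norm_num
  intro i j
  rw [EuclideanSpace.inner_eq_star_dotProduct]
  fin_cases i <;> fin_cases j <;> simp [frame, dotProduct, Fin.sum_univ_three] <;> nlinarith [key]

/-- The frame as an orthonormal basis of `V`. [folklore] -/
def frameBasis : OrthonormalBasis (Fin 3) ℝ V :=
  OrthonormalBasis.mk frame_orthonormal (by
    rw [frame_orthonormal.linearIndependent.span_eq_top_of_card_eq_finrank' (by simp)])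

/-- The rotation `R x = ((x₀+x₂)/√2, x₁, (x₂-x₀)/√2)` (coordinates in the frame). [folklore] -/
def rot : V ≃ₗᵢ[ℝ] V := frameBasis.repr

/-- Coordinates in the frame are inner products with the frame vectors. [folklore] -/
theorem rot_apply (x : V) (i : Fin 3) : rot x i = ⟪frame i, x⟫ := by
  rw [rot, frameBasis]
  simp [OrthonormalBasis.repr_apply_apply]

/-- `(R x)₀ = (x₀ + x₂)/√2`. [folklore] -/
theorem rot_apply_zero (x : V) : rot x 0 = (x 0 + x 2) / Real.sqrt 2 := by
  rw [rot_apply, EuclideanSpace.inner_eq_star_dotProduct]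
  simp [frame, dotProduct, Fin.sum_univ_three]
  ring

/-- `(R x)₁ = x₁`. [folklore] -/
theorem rot_apply_one (x : V) : rot x 1 = x 1 := by
  rw [rot_apply, EuclideanSpace.inner_eq_star_dotProduct]
  simp [frame, dotProduct, Fin.sum_univ_three]

/-- `(R x)₂ = (x₂ - x₀)/√2`. [folklore] -/
theorem rot_apply_two (x : V) : rot x 2 = (x 2 - x 0) / Real.sqrt 2 := by
  rw [rot_apply, EuclideanSpace.inner_eq_star_dotProduct]
  simp [frame, dotProduct, Fin.sum_univ_three]
  ring


/-! ### The rotated function at the base point and its Fourier transform -/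

/-- `e^{-π a u²}`. [folklore] -/
def gauss (a : ℂ) (u : ℝ) : ℂ := cexp (-π * a * u ^ 2)

/-- Gaussian parameter of the `(X²+Y²)`-direction (negative line) at `w = i`: `4 i z̄`. [folklore] -/
def aS (z : ℍ) : ℂ := 4 * I * (starRingEnd ℂ) (z : ℂ)

/-- Gaussian parameter of the `XY`-direction at `w = i`: `-2 i z`. [folklore] -/
def aB (z : ℍ) : ℂ := -2 * I * z

/-- Gaussian parameter of the `(Y²-X²)`-direction at `w = i`: `-4 i z`. [folklore] -/
def aT (z : ℍ) : ℂ := -4 * I * z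

/-- Real part of `a_S`: `4 Im z`. [folklore] -/
theorem aS_re (z : ℍ) : (aS z).re = 4 * z.im := by
  simp [aS, Complex.mul_re]

/-- Real part of `a_B`: `2 Im z`. [folklore] -/
theorem aB_re (z : ℍ) : (aB z).re = 2 * z.im := by
  simp [aB, Complex.mul_re]

/-- Real part of `a_T`: `4 Im z`. [folklore] -/
theorem aT_re (z : ℍ) : (aT z).re = 4 * z.im := by
  simp [aT, Complex.mul_re]

/-- `Re a_S > 0`. [folklore] -/
theorem aS_re_pos (z : ℍ) : 0 < (aS z).re := by rw [aS_re]; linarith [z.im_pos]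
/-- `Re a_B > 0`. [folklore] -/
theorem aB_re_pos (z : ℍ) : 0 < (aB z).re := by rw [aB_re]; linarith [z.im_pos]
/-- `Re a_T > 0`. [folklore] -/
theorem aT_re_pos (z : ℍ) : 0 < (aT z).re := by rw [aT_re]; linarith [z.im_pos]

/-- The Shintani–Schwartz function at `w = i` in the rotated coordinates `u = R x`:
`(√2 u₂ + i u₁) e^{-π(a_S u₀² + a_B u₁² + a_T u₂²)}`. [folklore] -/
def fRot (z : ℍ) (u : V) : ℂ :=
  (Real.sqrt 2 * u 2 + I * u 1) * (gauss (aS z) (u 0) * gauss (aB z) (u 1) * gauss (aT z) (u 2))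

/-- `√2 ≠ 0` in `ℂ`. [folklore] -/
private theorem sqrt_two_ne_zero' : ((Real.sqrt 2 : ℝ) : ℂ) ≠ 0 :=
  ofReal_ne_zero.mpr (by positivity)

/-- `(√2)² = 2` in `ℂ`. [folklore] -/
private theorem sqrt_two_sq' : ((Real.sqrt 2 : ℝ) : ℂ) ^ 2 = 2 := by
  rw [← ofReal_pow, Real.sq_sqrt (by norm_num : (0:ℝ) ≤ 2)]; norm_num

/-- `s² = (x₀ + x₂)²/2`. [folklore] -/
theorem rot_zero_sq (x : V) : rot x 0 ^ 2 = (x 0 + x 2) ^ 2 / 2 := by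
  rw [rot_apply_zero, div_pow, Real.sq_sqrt (by norm_num : (0:ℝ) ≤ 2)]

/-- `t² = (x₂ - x₀)²/2`. [folklore] -/
theorem rot_two_sq (x : V) : rot x 2 ^ 2 = (x 2 - x 0) ^ 2 / 2 := by
  rw [rot_apply_two, div_pow, Real.sq_sqrt (by norm_num : (0:ℝ) ≤ 2)]

/-- `z = Re z + i Im z` for `z ∈ ℍ`. [folklore] -/
theorem coe_eq_re_add_im (z : ℍ) : (z : ℂ) = ((z : ℂ).re : ℂ) + ((z : ℂ).im : ℂ) * I :=
  (Complex.re_add_im _).symm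

/-- `z̄ = Re z - i Im z` for `z ∈ ℍ`. [folklore] -/
theorem conj_coe_eq (z : ℍ) :
    (starRingEnd ℂ) (z : ℂ) = ((z : ℂ).re : ℂ) - ((z : ℂ).im : ℂ) * I :=
  Complex.ext (by simp) (by simp)

/-- **Principal axes at `w = i`**: `f_i(x) = fRot (R x)`, i.e.
`x(i,1) = √2 t + i b` and `Re z · disc + i Im z · q_i⁺ = z (b² + 2t²) - z̄ · 2s²` in the coordinates
`(s, b, t) = R x`. [cite: Shintani1975, Remark 2.1] -/
theorem shintaniFn_I (z : ℍ) (x : V) : shintaniFn UpperHalfPlane.I z x = fRot z (rot x) := by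
  have hpoly : formEval x ((UpperHalfPlane.I : ℍ) : ℂ) =
      Real.sqrt 2 * rot x 2 + I * rot x 1 := by
    rw [rot_apply_two, rot_apply_one, formEval, UpperHalfPlane.coe_I]
    have h2 := sqrt_two_ne_zero'
    push_cast
    field_simp
    ring_nf
    rw [I_sq]
    ring
  unfold shintaniFn fRot
  rw [hpoly]
  congr 1
  rw [gauss, gauss, gauss, ← Complex.exp_add, ← Complex.exp_add]
  congr 1
  have e0 : ((rot x 0 : ℝ) : ℂ) ^ 2 = ((x 0 : ℝ) + x 2) ^ 2 / 2 := by
    rw [← ofReal_pow, rot_zero_sq]; push_cast; ring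
  have e2 : ((rot x 2 : ℝ) : ℂ) ^ 2 = ((x 2 : ℝ) - x 0) ^ 2 / 2 := by
    rw [← ofReal_pow, rot_two_sq]; push_cast; ring
  rw [rot_apply_one, majorant, pw, disc, aS, aB, aT]
  simp only [UpperHalfPlane.coe_I, Complex.normSq_I, UpperHalfPlane.I_im,
    UpperHalfPlane.I_re, mul_one, mul_zero, add_zero, div_one]
  rw [conj_coe_eq, coe_eq_re_add_im z]
  simp only [Complex.add_re, Complex.ofReal_re, Complex.mul_re, Complex.I_re, Complex.ofReal_im,
    Complex.I_im, Complex.add_im, Complex.mul_im, mul_zero, sub_zero, zero_add, mul_one, add_zero]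
  push_cast
  rw [e0, e2]
  ring_nf


/-! ### Fourier transform of `fRot` -/

/-- `e^{-π a u²}` is integrable for `Re a > 0`. [folklore] -/
theorem integrable_gauss {a : ℂ} (ha : 0 < a.re) : Integrable (gauss a) := by
  have h : (-π * a).re < 0 := by
    simpa only [neg_mul, neg_re, re_ofReal_mul, neg_lt_zero] using mul_pos pi_pos ha
  refine (integrable_cexp_quadratic' h 0 0).congr (ae_of_all _ fun u ↦ ?_)
  simp only [gauss, zero_mul, add_zero]

/-- `u e^{-π a u²}` is integrable for `Re a > 0`. [folklore] -/
theorem integrable_mul_gauss {a : ℂ} (ha : 0 < a.re) :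
    Integrable fun u : ℝ ↦ (u : ℂ) * gauss a u := by
  have h : (-π * a).re < 0 := by
    simpa only [neg_mul, neg_re, re_ofReal_mul, neg_lt_zero] using mul_pos pi_pos ha
  simpa [gauss] using integrable_mul_cexp_quadratic h 0

/-- `𝓕 (e^{-π a u²})(η) = a^{-1/2} e^{-π η²/a}` (Mathlib `fourier_gaussian_pi`). [folklore] -/
theorem fourier_gauss {a : ℂ} (ha : 0 < a.re) (η : ℝ) :
    𝓕 (gauss a) η = 1 / a ^ (1 / 2 : ℂ) * cexp (-π / a * η ^ 2) := by
  rw [show gauss a = fun x : ℝ ↦ cexp (-π * a * x ^ 2) from rfl]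
  exact congrFun (fourier_gaussian_pi ha) η

/-- `𝓕 (u e^{-π a u²})(η) = -(iη/a) a^{-1/2} e^{-π η²/a}`. [folklore] -/
theorem fourier_mul_gauss {a : ℂ} (ha : 0 < a.re) (η : ℝ) :
    𝓕 (fun u : ℝ ↦ (u : ℂ) * gauss a u) η =
      -(I * η / a) * (1 / a ^ (1 / 2 : ℂ) * cexp (-π / a * η ^ 2)) :=
  fourier_mul_gaussian_pi ha η

/-- Products of integrable one-variable functions are integrable on `ℝ³`. [folklore] -/
theorem integrable_euclidean_prod {g : Fin 3 → ℝ → ℂ} (hg : ∀ i, Integrable (g i)) :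
    Integrable (fun v : V ↦ ∏ i, g i (v i)) := by
  rw [← (PiLp.volume_preserving_toLp (Fin 3)).integrable_comp_emb
    (MeasurableEquiv.toLp 2 _).measurableEmbedding]
  exact Integrable.fintype_prod (f := g) hg

/-- Additivity of `𝓕` on integrable functions, pointwise. [folklore] -/
theorem fourier_add_apply {f g : V → ℂ} (hf : Integrable f) (hg : Integrable g) (ξ : V) :
    𝓕 (f + g) ξ = 𝓕 f ξ + 𝓕 g ξ := by
  simp only [fourier_eq, Pi.add_apply, smul_add]
  exact integral_add ((fourierIntegral_convergent_iff ξ).2 hf) ((fourierIntegral_convergent_iff ξ).2 hg)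

/-- `𝓕 (c f) = c 𝓕 f`, pointwise. [folklore] -/
theorem fourier_const_mul_apply (c : ℂ) (f : V → ℂ) (ξ : V) :
    𝓕 (fun x ↦ c * f x) ξ = c * 𝓕 f ξ := by
  simp only [fourier_eq, Circle.smul_def, ← integral_const_mul]
  exact integral_congr_ae (ae_of_all _ fun v ↦ by ring)

/-- First pure tensor of `fRot`. [folklore] -/
def tens1 (z : ℍ) : Fin 3 → ℝ → ℂ :=
  ![gauss (aS z), gauss (aB z), fun u ↦ (u : ℂ) * gauss (aT z) u]

/-- Second pure tensor of `fRot`. [folklore] -/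
def tens2 (z : ℍ) : Fin 3 → ℝ → ℂ :=
  ![gauss (aS z), fun u ↦ (u : ℂ) * gauss (aB z) u, gauss (aT z)]

/-- `fRot` as a sum of two pure tensors. [folklore] -/
theorem fRot_eq (z : ℍ) : fRot z =
    (fun u : V ↦ (Real.sqrt 2 : ℂ) * ∏ i, tens1 z i (u i)) +
      fun u : V ↦ I * ∏ i, tens2 z i (u i) := by
  funext u
  simp only [fRot, tens1, tens2, Fin.prod_univ_three, Pi.add_apply, Matrix.cons_val_zero,
    Matrix.cons_val_one, Matrix.cons_val]
  ring

/-- The first pure tensor is integrable. [folklore] -/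
theorem integrable_tens1 (z : ℍ) : Integrable (fun v : V ↦ ∏ i, tens1 z i (v i)) := by
  apply integrable_euclidean_prod
  intro i
  fin_cases i
  · exact integrable_gauss (aS_re_pos z)
  · exact integrable_gauss (aB_re_pos z)
  · exact integrable_mul_gauss (aT_re_pos z)

/-- The second pure tensor is integrable. [folklore] -/
theorem integrable_tens2 (z : ℍ) : Integrable (fun v : V ↦ ∏ i, tens2 z i (v i)) := by
  apply integrable_euclidean_prod
  intro i
  fin_cases i
  · exact integrable_gauss (aS_re_pos z)
  · exact integrable_mul_gauss (aB_re_pos z)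
  · exact integrable_gauss (aT_re_pos z)

/-- **Fourier transform of the rotated base-point function** (product of one-dimensional Gaussian
transforms and one first moment). [folklore] -/
theorem fourier_fRot (z : ℍ) (η : V) : 𝓕 (fRot z) η =
    (1 / aS z ^ (1 / 2 : ℂ) * cexp (-π / aS z * η 0 ^ 2)) *
    (1 / aB z ^ (1 / 2 : ℂ) * cexp (-π / aB z * η 1 ^ 2)) *
    (1 / aT z ^ (1 / 2 : ℂ) * cexp (-π / aT z * η 2 ^ 2)) *
    ((Real.sqrt 2 : ℂ) * (-(I * η 2 / aT z)) + I * (-(I * η 1 / aB z))) := by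
  rw [fRot_eq, fourier_add_apply ((integrable_tens1 z).const_mul _) ((integrable_tens2 z).const_mul _),
    fourier_const_mul_apply, fourier_const_mul_apply, fourier_euclidean_prod, fourier_euclidean_prod]
  simp only [tens1, tens2, Fin.prod_univ_three, Matrix.cons_val_zero, Matrix.cons_val_one,
    Matrix.cons_val]
  rw [fourier_gauss (aS_re_pos z), fourier_gauss (aB_re_pos z), fourier_gauss (aT_re_pos z),
    fourier_mul_gauss (aT_re_pos z), fourier_mul_gauss (aB_re_pos z)]
  ring


/-! ### The inversion `z ↦ -1/(4z)` and the dual vector -/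

/-- `-1/(4z) = (-z)⁻¹/4`. [folklore] -/
theorem neg_one_div_four_mul_eq (z : ℍ) : (-1 / (4 * (z : ℂ))) = (-(z : ℂ))⁻¹ / 4 := by
  have hz := z.ne_zero
  field_simp

/-- `Im(-1/(4z)) > 0` for `z ∈ ℍ`. [folklore] -/
theorem im_neg_one_div_four_mul (z : ℍ) : 0 < (-1 / (4 * (z : ℂ))).im := by
  rw [neg_one_div_four_mul_eq, Complex.div_ofNat_im, Complex.inv_im, Complex.neg_im,
    Complex.normSq_neg, neg_neg]
  have h1 : 0 < Complex.normSq (z : ℂ) := Complex.normSq_pos.mpr z.ne_zero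
  have h2 := z.im_pos
  have h3 : (z : ℂ).im = z.im := rfl
  rw [h3]
  positivity

/-- `z ↦ -1/(4z)` on `ℍ` (the level-`4` Fricke involution). [folklore] -/
def invFour (z : ℍ) : ℍ := ⟨-1 / (4 * (z : ℂ)), im_neg_one_div_four_mul z⟩

/-- Coercion of `invFour z`. [folklore] -/
@[simp] theorem coe_invFour (z : ℍ) : (invFour z : ℂ) = -1 / (4 * (z : ℂ)) := rfl

/-- The dual vector `S⁻¹ξ = (-ξ₂/2, ξ₁, -ξ₀/2)` (`S` the Gram matrix of the discriminant form). [folklore] -/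
def sinv (ξ : V) : V := !₂[-ξ 2 / 2, ξ 1, -ξ 0 / 2]

/-- `(S⁻¹ξ)₀ = -ξ₂/2`. [folklore] -/
@[simp] theorem sinv_zero (ξ : V) : sinv ξ 0 = -ξ 2 / 2 := by simp [sinv]
/-- `(S⁻¹ξ)₁ = ξ₁`. [folklore] -/
@[simp] theorem sinv_one (ξ : V) : sinv ξ 1 = ξ 1 := by simp [sinv]
/-- `(S⁻¹ξ)₂ = -ξ₀/2`. [folklore] -/
@[simp] theorem sinv_two (ξ : V) : sinv ξ 2 = -ξ 0 / 2 := by simp [sinv]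

/-- The constant `κ(z) = (2z)⁻¹ a_S^{-1/2} a_B^{-1/2} a_T^{-1/2}` of the inversion formula. [folklore] -/
def kappa (z : ℍ) : ℂ :=
  1 / (2 * (z : ℂ)) * (1 / aS z ^ (1 / 2 : ℂ)) * (1 / aB z ^ (1 / 2 : ℂ)) * (1 / aT z ^ (1 / 2 : ℂ))

/-- The Shintani exponent in terms of `z` and `z̄`: `Re z · q + i Im z · (q + 2p²) = (p² + q) z - p² z̄`.
[folklore] -/
theorem exponent_eq_sub (z : ℍ) (q p : ℝ) :
    (((z : ℂ).re : ℂ) * q + I * (((z : ℂ).im : ℂ) * (q + 2 * p ^ 2)) : ℂ) =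
      ((p : ℂ) ^ 2 + q) * z - (p : ℂ) ^ 2 * (starRingEnd ℂ) (z : ℂ) := by
  apply Complex.ext
  · simp [Complex.mul_re, Complex.mul_im]; ring
  · simp [Complex.mul_re, Complex.mul_im]; ring

/-- `p_i(x) = x₀ + x₂`. [folklore] -/
theorem pw_I (x : V) : pw UpperHalfPlane.I x = x 0 + x 2 := by
  simp [pw]


/-! ### The inversion formula at the base point -/

/-- `conj(-1/(4z)) = -1/(4 z̄)`. [folklore] -/
theorem conj_coe_invFour (z : ℍ) :
    (starRingEnd ℂ) ((invFour z : ℍ) : ℂ) = -1 / (4 * (starRingEnd ℂ) (z : ℂ)) := by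
  simp only [coe_invFour, map_div₀, map_neg, map_one, map_mul, map_ofNat]

/-- `a_S ≠ 0`. [folklore] -/
theorem aS_ne_zero (z : ℍ) : aS z ≠ 0 := fun h ↦ by
  have := aS_re_pos z; rw [h] at this; simp at this
/-- `a_B ≠ 0`. [folklore] -/
theorem aB_ne_zero (z : ℍ) : aB z ≠ 0 := fun h ↦ by
  have := aB_re_pos z; rw [h] at this; simp at this
/-- `a_T ≠ 0`. [folklore] -/
theorem aT_ne_zero (z : ℍ) : aT z ≠ 0 := fun h ↦ by
  have := aT_re_pos z; rw [h] at this; simp at this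

/-- `z̄ ≠ 0` for `z ∈ ℍ`. [folklore] -/
theorem conj_coe_ne_zero (z : ℍ) : (starRingEnd ℂ) (z : ℂ) ≠ 0 :=
  (map_ne_zero _).mpr z.ne_zero

/-- The polynomial factor of `𝓕 f_i`: `√2(-iη₂/a_T) + i(-iη₁/a_B) = y(i,1)/(2z)`, `y = S⁻¹ξ`,
`η = Rξ`. [folklore] -/
theorem poly_factor_eq (z : ℍ) (ξ : V) :
    (Real.sqrt 2 : ℂ) * (-(I * (rot ξ 2 : ℝ) / aT z)) + I * (-(I * (rot ξ 1 : ℝ) / aB z)) =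
      formEval (sinv ξ) ((UpperHalfPlane.I : ℍ) : ℂ) / (2 * (z : ℂ)) := by
  rw [rot_apply_two, rot_apply_one, formEval, sinv_zero, sinv_one, sinv_two, UpperHalfPlane.coe_I,
    aT, aB]
  have hz := z.ne_zero
  have h2 := sqrt_two_ne_zero'
  push_cast
  field_simp
  ring_nf
  rw [I_sq]
  ring

/-- The Gaussian factor of `𝓕 f_i`: `e^{-π(η₀²/a_S + η₁²/a_B + η₂²/a_T)} = e^{2πi(Re z' q(y) + i Im z' q_i⁺(y))}`
with `z' = -1/(4z)`, `y = S⁻¹ξ`, `η = Rξ`. [folklore] -/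
theorem gauss_factor_eq (z : ℍ) (ξ : V) :
    cexp (-π / aS z * (rot ξ 0 : ℝ) ^ 2) * cexp (-π / aB z * (rot ξ 1 : ℝ) ^ 2) *
        cexp (-π / aT z * (rot ξ 2 : ℝ) ^ 2) =
      cexp (2 * π * I * ((((invFour z : ℍ) : ℂ)).re * disc (sinv ξ) +
        I * ((((invFour z : ℍ) : ℂ)).im * majorant UpperHalfPlane.I (sinv ξ)))) := by
  rw [← Complex.exp_add, ← Complex.exp_add]
  congr 1
  rw [majorant, pw_I]
  have key := exponent_eq_sub (invFour z) (disc (sinv ξ)) (sinv ξ 0 + sinv ξ 2)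
  push_cast at key ⊢
  rw [key, conj_coe_invFour, coe_invFour]
  have e0 : ((rot ξ 0 : ℝ) : ℂ) ^ 2 = ((ξ 0 : ℝ) + ξ 2) ^ 2 / 2 := by
    rw [← ofReal_pow, rot_zero_sq]; push_cast; ring
  have e2 : ((rot ξ 2 : ℝ) : ℂ) ^ 2 = ((ξ 2 : ℝ) - ξ 0) ^ 2 / 2 := by
    rw [← ofReal_pow, rot_two_sq]; push_cast; ring
  rw [e0, e2, rot_apply_one, disc, sinv_zero, sinv_one, sinv_two, aS, aB, aT]
  have hz := z.ne_zero
  have hzb := conj_coe_ne_zero z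
  push_cast
  field_simp
  ring_nf
  rw [I_sq]
  ring

/-- **Fourier transform of the Shintani–Schwartz function at the base point `w = i`**:
`𝓕 f^{(z)}_i (ξ) = κ(z) · f^{(-1/(4z))}_i (S⁻¹ ξ)`. [folklore] -/
theorem fourier_shintaniFn_I (z : ℍ) (ξ : V) :
    𝓕 (shintaniFn UpperHalfPlane.I z) ξ =
      kappa z * shintaniFn UpperHalfPlane.I (invFour z) (sinv ξ) := by
  have hfun : shintaniFn UpperHalfPlane.I z = fRot z ∘ rot := funext fun x ↦ shintaniFn_I z x
  rw [hfun, fourier_comp_linearIsometry, fourier_fRot]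
  have hP := poly_factor_eq z ξ
  have hE := gauss_factor_eq z ξ
  unfold kappa shintaniFn
  rw [← hE, hP]
  have hz := z.ne_zero
  field_simp


/-! ### Linear change of variables in the Fourier transform -/

/-- **Fourier transform under a linear change of variables**: for an invertible linear map `A` of a
euclidean space and a map `B` with `⟪A v, B ξ⟫ = ⟪v, ξ⟫` (i.e. `B = (A⁻¹)†`),
`𝓕 (f ∘ A) (ξ) = |det A|⁻¹ · 𝓕 f (B ξ)`. [folklore] -/
theorem fourier_comp_linearMap {W : Type*} [NormedAddCommGroup W] [InnerProductSpace ℝ W]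
    [FiniteDimensional ℝ W] [MeasurableSpace W] [BorelSpace W]
    (A : W →ₗ[ℝ] W) (hdet : LinearMap.det A ≠ 0) (B : W → W)
    (hB : ∀ v ξ, ⟪A v, B ξ⟫ = ⟪v, ξ⟫) (f : W → ℂ) (ξ : W) :
    𝓕 (f ∘ A) ξ = |(LinearMap.det A)⁻¹| • 𝓕 f (B ξ) := by
  rw [fourier_eq, fourier_eq]
  set G : W → ℂ := fun u ↦ 𝐞 (-⟪u, B ξ⟫) • f u with hG
  have h1 : (fun v ↦ 𝐞 (-⟪v, ξ⟫) • (f ∘ A) v) = G ∘ A := by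
    funext v
    simp only [hG, Function.comp_apply, hB]
  rw [h1]
  have hAe : MeasurableEmbedding A := by
    let e := (LinearMap.equivOfDetNeZero A hdet).toContinuousLinearEquiv
    have : (A : W → W) = e := rfl
    rw [this]
    exact e.toHomeomorph.measurableEmbedding
  have hmap := MeasureTheory.Measure.map_linearMap_addHaar_eq_smul_addHaar (μ := volume) hdet
  calc ∫ v, (G ∘ A) v = ∫ v, G (A v) := rfl
    _ = ∫ u, G u ∂(Measure.map A volume) := (hAe.integral_map G).symm
    _ = |(LinearMap.det A)⁻¹| • ∫ u, G u := by
        rw [hmap, integral_smul_measure, ENNReal.toReal_ofReal (abs_nonneg _)]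


/-! ### Moving the base point: `w = g · i`, `g = (v^{1/2}, u v^{-1/2}; 0, v^{-1/2})` -/

/-- Matrix of `x ↦ x ∘ g_w` on coefficient vectors (`g_w · i = w`). [folklore] -/
def mMat (w : ℍ) : Matrix (Fin 3) (Fin 3) ℝ :=
  !![w.im, 0, 0; 2 * w.re, 1, 0; w.re ^ 2 / w.im, w.re / w.im, 1 / w.im]

/-- The linear map `x ↦ x ∘ g_w`. [folklore] -/
def mLin (w : ℍ) : V →ₗ[ℝ] V := Matrix.toEuclideanLin (mMat w)

/-- Entries of `M_w x`. [folklore] -/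
theorem mLin_apply (w : ℍ) (x : V) (i : Fin 3) : mLin w x i = ∑ j, mMat w i j * x j := by
  simp [mLin, Matrix.toLpLin_apply, Matrix.mulVec, dotProduct]

/-- `(M_w x)₀ = v x₀`. [folklore] -/
theorem mLin_apply_zero (w : ℍ) (x : V) : mLin w x 0 = w.im * x 0 := by
  simp [mLin_apply, mMat, Fin.sum_univ_three]

/-- `(M_w x)₁ = 2u x₀ + x₁`. [folklore] -/
theorem mLin_apply_one (w : ℍ) (x : V) : mLin w x 1 = 2 * w.re * x 0 + x 1 := by
  simp [mLin_apply, mMat, Fin.sum_univ_three]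

/-- `(M_w x)₂ = (u²x₀ + u x₁ + x₂)/v`. [folklore] -/
theorem mLin_apply_two (w : ℍ) (x : V) :
    mLin w x 2 = w.re ^ 2 / w.im * x 0 + w.re / w.im * x 1 + 1 / w.im * x 2 := by
  simp [mLin_apply, mMat, Fin.sum_univ_three]

/-- `det M_w = 1`. [folklore] -/
theorem det_mLin (w : ℍ) : LinearMap.det (mLin w) = 1 := by
  rw [mLin]
  dsimp only [Matrix.toEuclideanLin]
  rw [Matrix.toLpLin_eq_toLin, LinearMap.det_toLin, mMat, Matrix.det_fin_three]
  have hv := w.im_ne_zero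
  simp [hv]

/-- The inverse adjoint `(M_w⁻¹)ᵀ`. [folklore] -/
def nMap (w : ℍ) (ξ : V) : V :=
  !₂[ξ 0 / w.im - 2 * w.re / w.im * ξ 1 + w.re ^ 2 / w.im * ξ 2, ξ 1 - w.re * ξ 2, w.im * ξ 2]

/-- `(N_w ξ)₀`. [folklore] -/
@[simp] theorem nMap_zero (w : ℍ) (ξ : V) :
    nMap w ξ 0 = ξ 0 / w.im - 2 * w.re / w.im * ξ 1 + w.re ^ 2 / w.im * ξ 2 := by simp [nMap]
/-- `(N_w ξ)₁`. [folklore] -/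
@[simp] theorem nMap_one (w : ℍ) (ξ : V) : nMap w ξ 1 = ξ 1 - w.re * ξ 2 := by simp [nMap]
/-- `(N_w ξ)₂`. [folklore] -/
@[simp] theorem nMap_two (w : ℍ) (ξ : V) : nMap w ξ 2 = w.im * ξ 2 := by simp [nMap]

/-- The inner product on `ℝ³` written out. [folklore] -/
theorem inner_eq_sum_three (x y : V) : ⟪x, y⟫ = x 0 * y 0 + x 1 * y 1 + x 2 * y 2 := by
  rw [EuclideanSpace.inner_eq_star_dotProduct]
  simp [dotProduct, Fin.sum_univ_three, mul_comm]

/-- `⟪M_w v, N_w ξ⟫ = ⟪v, ξ⟫`: `N_w = (M_w⁻¹)ᵀ`. [folklore] -/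
theorem inner_mLin_nMap (w : ℍ) (v ξ : V) : ⟪mLin w v, nMap w ξ⟫ = ⟪v, ξ⟫ := by
  rw [inner_eq_sum_three, inner_eq_sum_three, mLin_apply_zero, mLin_apply_one, mLin_apply_two,
    nMap_zero, nMap_one, nMap_two]
  have hv := w.im_ne_zero
  field_simp
  ring

/-- `M_w` preserves the discriminant (`det g_w = 1`). [folklore] -/
theorem disc_mLin (w : ℍ) (x : V) : disc (mLin w x) = disc x := by
  rw [disc, disc, mLin_apply_zero, mLin_apply_one, mLin_apply_two]
  have hv := w.im_ne_zero
  field_simp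
  ring

/-- `p_i(M_w x) = p_w(x)` (the majorant is transported). [folklore] -/
theorem pw_mLin (w : ℍ) (x : V) : pw UpperHalfPlane.I (mLin w x) = pw w x := by
  rw [pw_I, pw, mLin_apply_zero, mLin_apply_two, Complex.normSq_apply]
  have hv := w.im_ne_zero
  rw [UpperHalfPlane.coe_re, UpperHalfPlane.coe_im]
  field_simp
  ring

/-- `q_i⁺(M_w x) = q_w⁺(x)`. [folklore] -/
theorem majorant_mLin (w : ℍ) (x : V) :
    majorant UpperHalfPlane.I (mLin w x) = majorant w x := by
  rw [majorant, majorant, disc_mLin, pw_mLin]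

/-- `(M_w x)(i,1) = x(w,1)/Im w` (homogeneity of degree `2`). [folklore] -/
theorem formEval_mLin (w : ℍ) (x : V) :
    formEval (mLin w x) ((UpperHalfPlane.I : ℍ) : ℂ) = formEval x w / (w.im : ℂ) := by
  rw [formEval, formEval, mLin_apply_zero, mLin_apply_one, mLin_apply_two, UpperHalfPlane.coe_I]
  have hv : (w.im : ℂ) ≠ 0 := ofReal_ne_zero.mpr w.im_ne_zero
  conv_rhs => rw [coe_eq_re_add_im w]
  rw [UpperHalfPlane.coe_re, UpperHalfPlane.coe_im]
  push_cast
  field_simp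
  ring_nf

/-- **Equivariance in `w`**: `f_w(x) = Im w · f_i(M_w x)`. [cite: Shintani1975, (2.12)] -/
theorem shintaniFn_eq_mLin (w z : ℍ) (x : V) :
    shintaniFn w z x = (w.im : ℂ) * shintaniFn UpperHalfPlane.I z (mLin w x) := by
  rw [shintaniFn, shintaniFn, formEval_mLin, disc_mLin, majorant_mLin]
  have hv : (w.im : ℂ) ≠ 0 := ofReal_ne_zero.mpr w.im_ne_zero
  field_simp

/-- `M_w S⁻¹ = S⁻¹ N_w` (`M_w` is an isometry of the discriminant form). [folklore] -/
theorem mLin_sinv (w : ℍ) (ξ : V) : mLin w (sinv ξ) = sinv (nMap w ξ) := by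
  have hv := w.im_ne_zero
  ext i
  fin_cases i
  · simp [mLin_apply_zero]; ring
  · simp [mLin_apply_one]; ring
  · simp [mLin_apply_two]; field_simp; ring

/-- **Fourier transform of the Shintani–Schwartz function** (all `w ∈ ℍ`):
`𝓕 f^{(z)}_w (ξ) = κ(z) · f^{(-1/(4z))}_w (S⁻¹ ξ)`. [cite: Shintani1975, Prop. 1.6] -/
theorem fourier_shintaniFn (w z : ℍ) (ξ : V) :
    𝓕 (shintaniFn w z) ξ = kappa z * shintaniFn w (invFour z) (sinv ξ) := by
  have h1 : shintaniFn w z = fun x ↦ (w.im : ℂ) * (shintaniFn UpperHalfPlane.I z ∘ mLin w) x :=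
    funext fun x ↦ shintaniFn_eq_mLin w z x
  rw [h1, fourier_const_mul_apply, fourier_comp_linearMap (mLin w) (by rw [det_mLin]; exact one_ne_zero)
    (nMap w) (inner_mLin_nMap w) _ ξ, det_mLin, fourier_shintaniFn_I, ← mLin_sinv,
    shintaniFn_eq_mLin w (invFour z) (sinv ξ)]
  simp
  ring

end Literature.NumberTheory.EllipticCurves.Shintani
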